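import Summits.QuantumAdvantage.QuantumAdvantage.Theorems.WbwVerifiableLineNoSpeedup.Negative.LoadBearing
import Literature.Computability.QuantumComplexity.RandomizedQuerySimulation

/-!
# `WbwVerifiableLineNoSpeedup` (stmt-QuantumAdvantage-2239) — negative / calibration lemmas, II: pointwise truth and tightness

Sequel to `LoadBearing.lean` (same provenance: refuter work file
`Summits/QuantumAdvantage/QuantumAdvantage/Cruxes/WbwVerifiableLineNoSpeedup/Disproof.lean`, cycle 1).
Sorry-free; no statement of the route is asserted positively.

* §3 `one_le_svlQ`, `one_le_svlQ_of_hyps` (`Q ≥ 1` under the hypotheses: the sink bit is not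
  constant on the promise — straight line `0,…,T` versus bent line `0,…,T-1,T+1`),
  `pointwise_bound` — the QUANTIFIER-SWAPPED crux `∀ m T, hyps → ∃ c > 0, …` is TRUE, so any
  refutation of the crux must be an asymptotic family of parameters (a new algorithm), never a
  finite computation.
* §4 `svlQ_le_mul` (`Q ≤ m·T`, walk: `Q ≤ R ≤ D` and the tree's line-following tree),
  `svlQ_one_eq_one` (`Q(m,1) = 1`), `admissible_const_le_one` (every admissible `c ≤ 1`),
  `not_groverBranchOnly` — the strengthening with `min (T+1) √(2^m)` replaced by `√(2^m)` alone
  is FALSE (the walk branch is necessary; it is attained up to the factor `m²`).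
-/

noncomputable section

set_option linter.dupNamespace false

namespace Summit.QuantumAdvantage.QuantumAdvantage.Theorems.WbwVerifiableLineNoSpeedup.Negative

open Literature.Computability.Cryptography Literature.Computability.QuantumComplexity
  Literature.Computability.Complexity
open Summit.QuantumAdvantage.QuantumAdvantage.Theses.WhiteBoxWalk (WbwVerifiableLineNoSpeedup)

/-! ## §3 The pointwise weakening holds: `Q ≥ 1` under the hypotheses -/

/-- The successor table of the line `xs`: `S(xs i) = xs (i+1)` for `i < T`, identity elsewhere. [folklore] -/
def lineSucc {m T : ℕ} (xs : Fin (T + 1) → Fin (2 ^ m)) (x : Fin (2 ^ m)) : Fin (2 ^ m) :=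
  if h : ∃ i : Fin T, xs i.castSucc = x then xs (Classical.choose h).succ else x

/-- The input `(S, V)` of the line `xs`. [folklore] -/
def lineInput {m T : ℕ} (xs : Fin (T + 1) → Fin (2 ^ m)) : SVLInput m T :=
  svlInput m T (lineSucc xs) fun x i => decide (x = xs i)

/-- For an injective `xs` with `xs 0 = 0`, `lineInput xs` is in the promise set with line `xs`. [folklore] -/
theorem isSvlLine_lineInput {m T : ℕ} {xs : Fin (T + 1) → Fin (2 ^ m)}
    (hinj : Function.Injective xs) (h0 : (xs 0).val = 0) : IsSvlLine (lineInput xs) xs := by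
  rw [isSvlLine_iff]
  refine ⟨hinj, h0, fun i => ?_, fun x i => ?_⟩
  · rw [lineInput, svlSucc_svlInput, lineSucc]
    have hex : ∃ i' : Fin T, xs i'.castSucc = xs i.castSucc := ⟨i, rfl⟩
    rw [dif_pos hex]
    have hi : Classical.choose hex = i := by
      have := Classical.choose_spec hex
      exact Fin.castSucc_injective _ (hinj this)
    rw [hi]
  · rw [lineInput, svlVerify_svlInput]

/-- Hence `lineInput xs ∈ svlPromise m T`. [folklore] -/
theorem lineInput_mem {m T : ℕ} {xs : Fin (T + 1) → Fin (2 ^ m)}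
    (hinj : Function.Injective xs) (h0 : (xs 0).val = 0) : lineInput xs ∈ svlPromise m T :=
  ⟨xs, isSvlLine_lineInput hinj h0⟩

/-- And its sink bit is the parity of `xs T`. [folklore] -/
theorem svlSinkBit_lineInput {m T : ℕ} {xs : Fin (T + 1) → Fin (2 ^ m)}
    (hinj : Function.Injective xs) (h0 : (xs 0).val = 0) :
    svlSinkBit m T (lineInput xs) = decide ((xs (Fin.last T)).val % 2 = 1) :=
  (isSvlLine_lineInput hinj h0).svlSinkBit_eq

/-- The bent line `0, 1, …, T-1, T+1` (requires `T + 2 ≤ 2^m`). [folklore] -/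
def bentLine {m T : ℕ} (h : T + 2 ≤ 2 ^ m) (i : Fin (T + 1)) : Fin (2 ^ m) :=
  if i = Fin.last T then ⟨T + 1, by omega⟩ else ⟨i.val, by omega⟩

/-- The bent line is simple. [folklore] -/
theorem bentLine_injective {m T : ℕ} (h : T + 2 ≤ 2 ^ m) : Function.Injective (bentLine h) := by
  intro i j hij
  unfold bentLine at hij
  by_cases hi : i = Fin.last T <;> by_cases hj : j = Fin.last T
  · rw [hi, hj]
  · rw [if_pos hi, if_neg hj] at hij
    have := Fin.mk.inj_iff.1 hij
    have hj' := j.isLt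
    omega
  · rw [if_neg hi, if_pos hj] at hij
    have := Fin.mk.inj_iff.1 hij
    have hi' := i.isLt
    omega
  · rw [if_neg hi, if_neg hj] at hij
    exact Fin.ext (Fin.mk.inj_iff.1 hij)

/-- The bent line starts at `0` (for `T ≥ 1`). [folklore] -/
theorem bentLine_zero {m T : ℕ} (h : T + 2 ≤ 2 ^ m) (hT : 1 ≤ T) : (bentLine h 0).val = 0 := by
  have h0 : (0 : Fin (T + 1)) ≠ Fin.last T := by
    intro h0
    have := congrArg Fin.val h0
    simp at this
    omega
  simp [bentLine, h0]

/-- The bent line ends at `T + 1`. [folklore] -/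
theorem bentLine_last {m T : ℕ} (h : T + 2 ≤ 2 ^ m) : (bentLine h (Fin.last T)).val = T + 1 := by
  simp [bentLine]

/-- **`Q ≥ 1` pointwise.** For `1 ≤ T` and `T + 2 ≤ 2^m` (implied by the crux's hypotheses) the
sink bit takes both values on the promise (straight line ends at `T`, bent line at `T + 1`), so
no zero-query algorithm computes it: `1 ≤ Q_{1/3}`. [folklore] -/
theorem one_le_svlQ {m T : ℕ} (hT : 1 ≤ T) (h : T + 2 ≤ 2 ^ m) : 1 ≤ svlQ m T := by
  have hs : T + 1 ≤ 2 ^ m := (Nat.le_succ _).trans h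
  have hA := lineInput_mem (m := m) (xs := svlStraightLine hs)
    (fun i j hij => Fin.ext (Fin.mk.inj_iff.1 hij)) rfl
  have hAbit := svlSinkBit_lineInput (m := m) (xs := svlStraightLine hs)
    (fun i j hij => Fin.ext (Fin.mk.inj_iff.1 hij)) rfl
  have hB := lineInput_mem (bentLine_injective h) (bentLine_zero h hT)
  have hBbit := svlSinkBit_lineInput (bentLine_injective h) (bentLine_zero h hT)
  rw [bentLine_last] at hBbit
  have hlastA : (svlStraightLine hs (Fin.last T)).val = T := rfl
  rw [hlastA] at hAbit
  rcases Nat.even_or_odd T with hev | hodd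
  · rw [Nat.even_iff] at hev
    refine one_le_quantumQueryComplexityOn_of_nonconst hA hB ?_ ?_
    · rw [hAbit, decide_eq_false_iff_not]
      omega
    · rw [hBbit, decide_eq_true_iff]
      omega
  · rw [Nat.odd_iff] at hodd
    refine one_le_quantumQueryComplexityOn_of_nonconst hB hA ?_ ?_
    · rw [hBbit, decide_eq_false_iff_not]
      omega
    · rw [hAbit, decide_eq_true_iff]
      omega

/-- `Q ≥ 1` under the crux's literal hypotheses. [folklore] -/
theorem one_le_svlQ_of_hyps {m T : ℕ} (hT : 1 ≤ T) (hTm : T + 1 ≤ 2 ^ (m - 1)) : 1 ≤ svlQ m T :=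
  one_le_svlQ hT (succ_succ_le_two_pow_of_hyps hT hTm)

/-- **The quantifier-swapped weakening of the crux is TRUE**: for each admissible `(m, T)` there
is a `c > 0` with `c · min (T+1) √(2^m) / m ≤ Q` (take `c = m/(T+1)` and use `Q ≥ 1`). Hence no
finite set of parameters can refute the crux; any disproof is an asymptotic algorithm. [folklore] -/
theorem pointwise_bound (m T : ℕ) (hm : 2 ≤ m) (hT : 1 ≤ T) (hTm : T + 1 ≤ 2 ^ (m - 1)) :
    ∃ c : ℝ, 0 < c ∧ c * min ((T : ℝ) + 1) (Real.sqrt (2 ^ m)) / m ≤ (svlQ m T : ℝ) := by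
  have hQ : (1 : ℝ) ≤ (svlQ m T : ℝ) := by exact_mod_cast one_le_svlQ_of_hyps hT hTm
  have hmpos : (0 : ℝ) < m := by exact_mod_cast (lt_of_lt_of_le (by norm_num) hm)
  have hT1 : (0 : ℝ) < (T : ℝ) + 1 := by positivity
  refine ⟨m / ((T : ℝ) + 1), by positivity, ?_⟩
  calc m / ((T : ℝ) + 1) * min ((T : ℝ) + 1) (Real.sqrt (2 ^ m)) / m
      ≤ m / ((T : ℝ) + 1) * ((T : ℝ) + 1) / m := by
        gcongr
        exact min_le_left _ _
    _ = 1 := by field_simp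
    _ ≤ (svlQ m T : ℝ) := hQ

/-! ## §4 Tightness of the walk branch; the Grover branch alone is refuted -/

/-- **Walk upper bound** `Q ≤ m · T` (follow the line: the tree's `svlLineTree`, then
`Q_{1/3} ≤ R_{1/3} ≤ D`). So the crux is within a factor `m²/c` of optimal whenever
`T + 1 ≤ √(2^m)`. [folklore] -/
theorem svlQ_le_mul (m T : ℕ) : svlQ m T ≤ m * T :=
  (quantumQueryComplexityOn_le_randQueryComplexityOn (by norm_num) _ _).trans
    (randQueryComplexityOn_svlPromise_le m T (by norm_num))

/-- The one-query tree reading bit `0` of `S(0)`, i.e. the parity of `x₁`. [folklore] -/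
def bitZeroTree (m : ℕ) (hm : 1 ≤ m) : DecisionTree (2 ^ m * m + 2 ^ m * (1 + 1)) :=
  .query (svlSuccIndex m 1 ⟨0, Nat.two_pow_pos m⟩ ⟨0, hm⟩) (.leaf false) (.leaf true)

/-- `bitZeroTree` has depth `1`. [folklore] -/
theorem bitZeroTree_depth (m : ℕ) (hm : 1 ≤ m) : (bitZeroTree m hm).depth = 1 := by
  simp [bitZeroTree, DecisionTree.depth]

/-- At `T = 1` the sink bit is bit `0` of `S(0)`: the one-query tree computes it on the promise. [folklore] -/
theorem bitZeroTree_computesOn (m : ℕ) (hm : 1 ≤ m) :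
    (bitZeroTree m hm).ComputesOn (svlPromise m 1) (svlSinkBit m 1) := by
  rintro t ⟨xs, hxs⟩
  have h0 : (⟨0, Nat.two_pow_pos m⟩ : Fin (2 ^ m)) = xs (0 : Fin 1).castSucc :=
    Fin.ext (by simpa using hxs.source.symm)
  have hbit := hxs.2.2.1 0 ⟨0, hm⟩
  rw [← h0] at hbit
  rw [hxs.svlSinkBit_eq, show Fin.last 1 = (0 : Fin 1).succ from rfl, ← Nat.testBit_zero]
  change (DecisionTree.query _ _ _).eval t = _
  rw [DecisionTree.eval]
  unfold svlSuccBit at hbit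
  rw [hbit]
  cases (xs (Fin.succ 0)).val.testBit 0 <;> rfl

/-- **`Q(m, 1) ≤ 1`**: one classical query suffices at `T = 1`. [folklore] -/
theorem svlQ_one_le_one {m : ℕ} (hm : 1 ≤ m) : svlQ m 1 ≤ 1 := by
  have hD : detQueryComplexityOn (svlPromise m 1) (svlSinkBit m 1) ≤ 1 :=
    (detQueryComplexityOn_le_depth _ (bitZeroTree_computesOn m hm)).trans
      (bitZeroTree_depth m hm).le
  exact ((quantumQueryComplexityOn_le_randQueryComplexityOn (by norm_num) _ _).trans
    (randQueryComplexityOn_le_det (by norm_num) _ _)).trans hD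

/-- Hence `Q(m, 1) = 1` for `m ≥ 2`. [folklore] -/
theorem svlQ_one_eq_one {m : ℕ} (hm : 2 ≤ m) : svlQ m 1 = 1 := by
  refine le_antisymm (svlQ_one_le_one (by omega)) (one_le_svlQ le_rfl ?_)
  calc 1 + 2 = 3 := rfl
    _ ≤ 2 ^ 2 := by norm_num
    _ ≤ 2 ^ m := Nat.pow_le_pow_right (by norm_num) hm

/-- **Every admissible constant is `≤ 1`**: at `(m, T) = (2, 1)` the crux reads
`c · min 2 2 / 2 = c ≤ Q(2, 1) = 1`. [folklore] -/
theorem admissible_const_le_one {c : ℝ}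
    (h : ∀ m T : ℕ, 2 ≤ m → 1 ≤ T → T + 1 ≤ 2 ^ (m - 1) →
      c * min ((T : ℝ) + 1) (Real.sqrt (2 ^ m)) / m ≤ (svlQ m T : ℝ)) : c ≤ 1 := by
  have h21 := h 2 1 le_rfl le_rfl (by norm_num)
  rw [svlQ_one_eq_one le_rfl] at h21
  have hs : Real.sqrt (2 ^ 2) = 2 := Real.sqrt_sq (by norm_num)
  have hmin : min ((1 : ℕ) + 1 : ℝ) (Real.sqrt (2 ^ 2)) = 2 := by
    rw [hs]
    exact (min_eq_left (by norm_num)).trans (by norm_num)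
  rw [hmin] at h21
  norm_num at h21
  exact h21

/-- `k³ ≤ 2^k` for `k ≥ 10`. [folklore] -/
theorem cube_le_two_pow {k : ℕ} (hk : 10 ≤ k) : k ^ 3 ≤ 2 ^ k := by
  induction k, hk using Nat.le_induction with
  | base => norm_num
  | succ k hk ih =>
    have h1 : 3 * k ^ 2 + 3 * k + 1 ≤ k ^ 3 := by
      have hk2 : 10 * k ≤ k ^ 2 := by nlinarith
      have hk3 : 10 * k ^ 2 ≤ k ^ 3 := by nlinarith
      linarith
    calc (k + 1) ^ 3 = k ^ 3 + (3 * k ^ 2 + 3 * k + 1) := by ring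
      _ ≤ k ^ 3 + k ^ 3 := Nat.add_le_add_left h1 _
      _ ≤ 2 ^ k + 2 ^ k := Nat.add_le_add ih ih
      _ = 2 ^ (k + 1) := by ring

/-- **Refuted strengthening: the walk branch of the `min` is necessary.** The crux with
`min (T+1) √(2^m)` replaced by its Grover branch `√(2^m)` alone is FALSE: at `T = 1`,
`Q(m, 1) ≤ 1` for all `m`, while `c · √(2^m) / m → ∞` (`m = 2k`, `k ≥ 10`, `k > 2/c`,
via `k³ ≤ 2^k`). [folklore] -/
theorem not_groverBranchOnly :
    ¬ ∃ c : ℝ, 0 < c ∧ ∀ m T : ℕ, 2 ≤ m → 1 ≤ T → T + 1 ≤ 2 ^ (m - 1) →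
      c * Real.sqrt (2 ^ m) / m ≤ (svlQ m T : ℝ) := by
  rintro ⟨c, hc, h⟩
  obtain ⟨k, hk⟩ := exists_nat_gt (max 10 (2 / c))
  have hk10 : 10 ≤ k := by
    have : (10 : ℝ) < k := lt_of_le_of_lt (le_max_left _ _) hk
    exact_mod_cast this.le
  have hkc : 2 / c < k := lt_of_le_of_lt (le_max_right _ _) hk
  have hkpos : (0 : ℝ) < k := by exact_mod_cast (lt_of_lt_of_le (by norm_num) hk10)
  have hm : 2 ≤ 2 * k := by omega
  have hTm : 1 + 1 ≤ 2 ^ (2 * k - 1) := by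
    calc 1 + 1 = 2 ^ 1 := rfl
      _ ≤ 2 ^ (2 * k - 1) := Nat.pow_le_pow_right (by norm_num) (by omega)
  have hQ := h (2 * k) 1 hm le_rfl hTm
  have hQ1 : (svlQ (2 * k) 1 : ℝ) ≤ 1 := by exact_mod_cast svlQ_one_le_one (m := 2 * k) (by omega)
  have hsqrt : Real.sqrt (2 ^ (2 * k)) = (2 : ℝ) ^ k := by
    have h22 : (2 : ℝ) ^ (2 * k) = ((2 : ℝ) ^ k) ^ 2 := by rw [← pow_mul, mul_comm]
    rw [h22]
    exact Real.sqrt_sq (by positivity)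
  have hcube : (k : ℝ) ^ 3 ≤ (2 : ℝ) ^ k := by exact_mod_cast cube_le_two_pow hk10
  rw [hsqrt] at hQ
  have hm' : ((2 * k : ℕ) : ℝ) = 2 * k := by norm_num
  rw [hm'] at hQ
  have h1 : c * (k : ℝ) ^ 3 / (2 * k) ≤ 1 := by
    calc c * (k : ℝ) ^ 3 / (2 * k) ≤ c * (2 : ℝ) ^ k / (2 * k) := by gcongr
      _ ≤ (svlQ (2 * k) 1 : ℝ) := hQ
      _ ≤ 1 := hQ1
  have h2 : c * (k : ℝ) ^ 3 / (2 * k) = c * k * k / 2 := by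
    rw [div_eq_div_iff (mul_ne_zero two_ne_zero hkpos.ne') two_ne_zero]
    ring
  rw [h2] at h1
  have hck : 2 < c * k := by
    have := (div_lt_iff₀ hc).1 hkc
    linarith
  have hk1 : (1 : ℝ) ≤ k := by exact_mod_cast (le_trans (by norm_num) hk10)
  nlinarith

end Summit.QuantumAdvantage.QuantumAdvantage.Theorems.WbwVerifiableLineNoSpeedup.Negative
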